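import Summits.BirchSwinnertonDyer.BirchSwinnertonDyer.Theorems.Rank2Observatory2DescFunctionals
import Mathlib.NumberTheory.LegendreSymbol.Basic
import Mathlib.NumberTheory.NumberField.Norm
import Mathlib.RingTheory.Ideal.Norm.AbsNorm
import HarnessLib

/-!
# BirchSwinnertonDyer — rank ≥ 2 observatory: per-field certificate checkers of the cubic-field 2-descent

HONEST FRAMING: per-curve certified theorems and census instruments; no claim on BSD in rank ≥ 2.

Generic file of the KERNEL-2DESC instrument (design `b2b-bsdr2-cert-3/KERNEL-2DESC.md` §4
A5(iii)–(iv)): the soundness lemmas that turn finite, kernel-decidable CERTIFICATES about a cubic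
field `K = ℚ(α)` into the hypotheses of `mordellWeilRank_le_of_coverSet` (`…2DescVCover`):

* NON-SQUARE WITNESSES by characters: a product that is a square has an even number of factors
  that are negative at a real place (`even_card_of_isSquare_real`), resp. quadratic non-residues
  under a residue map `𝓞 K → ℤ/p` (`even_card_of_isSquare_legendre`, via `legendreSym`); a
  parity certificate over finitely many characters therefore proves INDEPENDENCE MODULO SQUARES
  (`indep_of_parity_certificate`) — the hypothesis `hind` of `exists_isSquare_unit_mul_prod`
  (with `isSquare_of_isSquare_coe` to pass between `𝓞 K` and `K`);
* PRIME GENERATORS: an algebraic integer of prime norm is a prime element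
  (`prime_of_natAbs_norm_prime`), and a certified factorisation `F′(θ) = w·∏ Gⱼ^{eⱼ}` with `w` a
  unit and the `Gⱼ` prime gives the hypothesis `hD` (`assoc_of_factorisation`);
* SIGNS FROM AN ISOLATING INTERVAL: `c₀ + c₁x + c₂x²` is positive / negative on `lo < x < hi`
  (`0 ≤ lo`) under a decidable rational inequality (`quad_pos_of_interval`,
  `quad_neg_of_interval`);
* the COFACTOR condition of the real-sign functional is automatic for complex cubic fields:
  `Δ(F) < 0 ⇒ 0 < 3e² + 2Ae + 4B − A²` at the real root `e` (`cofactor_pos_of_disc_neg`, from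
  `Δ(F) = disc(F/(t−e))·F′(e)²`).

Sorry-free; axioms `propext`, `Classical.choice`, `Quot.sound`. Mathematics: folklore explicit
algebraic number theory (Marcus, *Number Fields*, Ch. 3–5); Cassels, *Lectures on Elliptic
Curves* §15.
-/

-- single-conjunct summit: `Summit.BirchSwinnertonDyer.BirchSwinnertonDyer.…` repeats the name by design
set_option linter.dupNamespace false

noncomputable section

open scoped Classical NumberField

open Literature.NumberTheory.NumberFields Polynomial Module NumberField

namespace Summit.BirchSwinnertonDyer.BirchSwinnertonDyer.Rank2Observatory.TwoDescCubic

/-! ## Non-square witnesses by characters -/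

section Characters

variable {R : Type*} [CommRing R] {ι : Type*}

/-- **Real character**: if `∏_{i ∈ T} wᵢ` is a square and no `ρ(wᵢ)` vanishes at the real place
`ρ`, the number of `i ∈ T` with `ρ(wᵢ) < 0` is even. [folklore] -/
theorem even_card_of_isSquare_real (ρ : R →+* ℝ) (w : ι → R) (hw : ∀ i, ρ (w i) ≠ 0)
    {T : Finset ι} (hsq : IsSquare (∏ i ∈ T, w i)) :
    Even (T.filter (fun i => ρ (w i) < 0)).card := by
  rw [← prod_pos_iff_even_card_neg T (fun i => ρ (w i)) hw]
  obtain ⟨r, hr⟩ := hsq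
  have h : ∏ i ∈ T, ρ (w i) = ρ r * ρ r := by rw [← map_prod, hr, map_mul]
  have hne : ∏ i ∈ T, ρ (w i) ≠ 0 := Finset.prod_ne_zero_iff.mpr (fun i _ => hw i)
  rw [h] at hne ⊢
  rcases lt_trichotomy (ρ r) 0 with hlt | heq | hgt
  · exact mul_pos_of_neg_of_neg hlt hlt
  · exact absurd (by rw [heq, mul_zero]) hne
  · exact mul_pos hgt hgt

/-- **Residue character**: for a ring map `ψ : R → ℤ/p` (`p` prime) and integers `rᵢ` with
`ψ(wᵢ) = rᵢ mod p`, `p ∤ rᵢ`: if `∏_{i ∈ T} wᵢ` is a square, the number of `i ∈ T` with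
`(rᵢ/p) = −1` is even. [folklore] -/
theorem even_card_of_isSquare_legendre {p : ℕ} [Fact p.Prime] (ψ : R →+* ZMod p) (w : ι → R)
    (r : ι → ℤ) (hr : ∀ i, ψ (w i) = (r i : ZMod p)) (hr0 : ∀ i, ((r i : ℤ) : ZMod p) ≠ 0)
    {T : Finset ι} (hsq : IsSquare (∏ i ∈ T, w i)) :
    Even (T.filter (fun i => legendreSym p (r i) = -1)).card := by
  -- the image is a non-zero square of `ℤ/p`, so its Legendre symbol is `1`
  have himg : IsSquare (((∏ i ∈ T, r i : ℤ) : ZMod p)) := by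
    have h := hsq.map ψ
    rw [map_prod, Finset.prod_congr rfl (fun i _ => hr i)] at h
    exact_mod_cast h
  have hne : ((∏ i ∈ T, r i : ℤ) : ZMod p) ≠ 0 := by
    push_cast
    exact Finset.prod_ne_zero_iff.mpr (fun i _ => hr0 i)
  have hleg : legendreSym p (∏ i ∈ T, r i) = 1 := (legendreSym.eq_one_iff p hne).mpr himg
  rw [show legendreSym p (∏ i ∈ T, r i) = ∏ i ∈ T, legendreSym p (r i) from
    map_prod (legendreSym.hom p) r T] at hleg
  -- a product of `±1`'s is `1` iff the number of `−1`'s is even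
  have key : ∀ S : Finset ι, ∏ i ∈ S, legendreSym p (r i) =
      (-1) ^ (S.filter (fun i => legendreSym p (r i) = -1)).card := by
    intro S
    induction S using Finset.induction_on with
    | empty => simp
    | insert j S hj ih =>
      rw [Finset.prod_insert hj, Finset.filter_insert, ih]
      rcases legendreSym.eq_one_or_neg_one p (hr0 j) with h1 | h1
      · rw [h1, if_neg (by decide), one_mul]
      · rw [h1, if_pos rfl, Finset.card_insert_of_notMem (by simp [hj]), pow_succ]
        ring
  rw [key] at hleg
  by_contra hodd
  rw [Nat.not_even_iff_odd] at hodd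
  rw [hodd.neg_one_pow] at hleg
  norm_num at hleg

/-- **Independence modulo squares from a parity certificate**: given finitely many parity tests
`bit k` (one per character), each SOUND — a square sub-product has an even number of factors
flagged by `bit k` — and a CERTIFICATE that every non-empty `T` is flagged oddly by some test, no
non-empty sub-product is a square. The certificate is kernel-decidable. [folklore] -/
theorem indep_of_parity_certificate {κ : Type*} (w : ι → R) (bit : κ → ι → Bool)
    (hsound : ∀ k (T : Finset ι), IsSquare (∏ i ∈ T, w i) →
      Even (T.filter (fun i => bit k i = true)).card)
    (hcert : ∀ T : Finset ι, T ≠ ∅ → ∃ k, Odd (T.filter (fun i => bit k i = true)).card)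
    (T : Finset ι) (hsq : IsSquare (∏ i ∈ T, w i)) : T = ∅ := by
  by_contra hne
  obtain ⟨k, hk⟩ := hcert T hne
  exact (Nat.not_even_iff_odd.mpr hk) (hsound k T hsq)

end Characters

section Integers

variable {K : Type*} [Field K] [NumberField K]

omit [NumberField K] in
/-- A square in `K` of an algebraic integer is a square in `𝓞 K` (`𝓞 K` is integrally closed).
[folklore] -/
theorem isSquare_of_isSquare_coe {x : 𝓞 K} (h : IsSquare ((x : 𝓞 K) : K)) : IsSquare x := by
  obtain ⟨r, hr⟩ := h
  have hint : IsIntegral ℤ r := by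
    refine IsIntegral.of_pow two_pos ?_
    rw [pow_two, ← hr]
    exact x.isIntegral_coe
  refine ⟨⟨r, hint⟩, ?_⟩
  apply RingOfIntegers.coe_injective
  simpa using hr

omit [NumberField K] in
/-- Square sub-products of an `𝓞 K`-family seen in `K`. [folklore] -/
theorem isSquare_prod_of_isSquare_prod_coe {ι : Type*} (w : ι → 𝓞 K) {T : Finset ι}
    (h : IsSquare (∏ i ∈ T, ((w i : 𝓞 K) : K))) : IsSquare (∏ i ∈ T, w i) := by
  apply isSquare_of_isSquare_coe
  rwa [← map_prod (algebraMap (𝓞 K) K)] at h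

/-! ## Prime generators and the divisors of `F′(θ)` -/

/-- **An algebraic integer of prime norm is a prime element** (its ideal has prime norm, hence is
a prime ideal). [cite: Marcus2018, Ch. 3, Thm. 22] -/
theorem prime_of_natAbs_norm_prime {x : 𝓞 K} (hp : ((Algebra.norm ℤ x).natAbs).Prime) :
    Prime x := by
  have hx0 : x ≠ 0 := by
    rintro rfl
    simp [Algebra.norm_zero] at hp
    exact Nat.not_prime_zero hp
  have hI : (Ideal.span ({x} : Set (𝓞 K))).IsPrime := by
    apply Ideal.isPrime_of_irreducible_absNorm
    rw [Ideal.absNorm_span_singleton]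
    exact hp
  exact (Ideal.span_singleton_prime hx0).mp hI

/-- The norm down to `ℤ` of an algebraic integer, read off in `ℚ`. [folklore] -/
theorem natAbs_norm_eq_of_norm_eq {x : 𝓞 K} {n : ℤ} (h : Algebra.norm ℚ ((x : 𝓞 K) : K) = n) :
    (Algebra.norm ℤ x).natAbs = n.natAbs := by
  have h' : ((Algebra.norm ℤ x : ℤ) : ℚ) = (n : ℚ) := by rw [Algebra.coe_norm_int, h]
  rw [Int.cast_inj.mp h']

/-- **The divisors of `F′(θ)` from a certified factorisation**: if `D = w·∏ⱼ Gⱼ^{eⱼ}` with `w`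
a unit and every `Gⱼ` prime, every prime `q ∣ D` is associated to some `Gⱼ` (hypothesis `hD` of
`mordellWeilRank_le_of_coverSet`). [folklore] -/
theorem assoc_of_factorisation {R : Type*} [CommRing R] [IsDomain R] {s : ℕ} {D w : R}
    {G : Fin s → R} {e : Fin s → ℕ} (hfac : D = w * ∏ j, G j ^ e j) (hw : IsUnit w)
    (hG : ∀ j, Prime (G j)) (q : R) (hq : Prime q) (hdvd : q ∣ D) : ∃ j, Associated q (G j) := by
  rw [hfac] at hdvd
  have h1 : q ∣ ∏ j, G j ^ e j := by
    rcases hq.dvd_or_dvd hdvd with h | h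
    · exact absurd (isUnit_of_dvd_unit h hw) hq.not_unit
    · exact h
  obtain ⟨j, -, hj⟩ := hq.exists_mem_finset_dvd h1
  exact ⟨j, (hq.irreducible.associated_of_dvd (hG j).irreducible (hq.dvd_of_dvd_pow hj))⟩

/-- A unit from a certified inverse. [folklore] -/
theorem isUnit_of_mul_eq_one' {R : Type*} [CommRing R] {w v : R} (h : w * v = 1) : IsUnit w :=
  IsUnit.of_mul_eq_one v h

end Integers

/-! ## Signs from an isolating interval; the cofactor for complex cubics -/

section Signs

/-- `0 < c₀ + c₁x + c₂x²` on `lo < x < hi` (`0 ≤ lo`) from the rational inequality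
`0 < c₀ + min(c₁lo, c₁hi) + min(c₂lo², c₂hi²)`. [folklore] -/
theorem quad_pos_of_interval {lo hi : ℚ} {x : ℝ} (h0 : 0 ≤ lo) (hlo : (lo : ℝ) < x) (hhi : x < hi)
    (c₀ c₁ c₂ : ℤ)
    (hc : 0 < (c₀ : ℚ) + min (c₁ * lo) (c₁ * hi) + min (c₂ * lo ^ 2) (c₂ * hi ^ 2)) :
    0 < (c₀ : ℝ) + c₁ * x + c₂ * x ^ 2 := by
  have hx0 : 0 ≤ x := le_trans (by exact_mod_cast h0) hlo.le
  have h1 : ((min (c₁ * lo) (c₁ * hi) : ℚ) : ℝ) ≤ c₁ * x := by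
    push_cast
    rcases le_total 0 (c₁ : ℝ) with hc1 | hc1
    · exact (min_le_left _ _).trans (by nlinarith)
    · exact (min_le_right _ _).trans (by nlinarith)
  have h2 : ((min (c₂ * lo ^ 2) (c₂ * hi ^ 2) : ℚ) : ℝ) ≤ c₂ * x ^ 2 := by
    push_cast
    have hlo0 : (0 : ℝ) ≤ lo := by exact_mod_cast h0
    have hlo2 : (lo : ℝ) ^ 2 ≤ x ^ 2 := pow_le_pow_left₀ hlo0 hlo.le 2
    have hhi2 : x ^ 2 ≤ (hi : ℝ) ^ 2 := pow_le_pow_left₀ hx0 hhi.le 2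
    rcases le_total 0 (c₂ : ℝ) with hc2 | hc2
    · exact (min_le_left _ _).trans (by nlinarith)
    · exact (min_le_right _ _).trans (by nlinarith)
  have hc' : (0 : ℝ) < (c₀ : ℚ) + ((min (c₁ * lo) (c₁ * hi) : ℚ) : ℝ) +
      ((min (c₂ * lo ^ 2) (c₂ * hi ^ 2) : ℚ) : ℝ) := by exact_mod_cast hc
  push_cast at hc' h1 h2 ⊢
  linarith

/-- `c₀ + c₁x + c₂x² < 0` on `lo < x < hi` (`0 ≤ lo`) from
`c₀ + max(c₁lo, c₁hi) + max(c₂lo², c₂hi²) < 0`. [folklore] -/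
theorem quad_neg_of_interval {lo hi : ℚ} {x : ℝ} (h0 : 0 ≤ lo) (hlo : (lo : ℝ) < x) (hhi : x < hi)
    (c₀ c₁ c₂ : ℤ)
    (hc : (c₀ : ℚ) + max (c₁ * lo) (c₁ * hi) + max (c₂ * lo ^ 2) (c₂ * hi ^ 2) < 0) :
    (c₀ : ℝ) + c₁ * x + c₂ * x ^ 2 < 0 := by
  have h := quad_pos_of_interval h0 hlo hhi (-c₀) (-c₁) (-c₂) (by
    have e1 : min (-c₁ * lo) (-c₁ * hi) = -max ((c₁ : ℚ) * lo) (c₁ * hi) := by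
      rw [← min_neg_neg]; ring_nf
    have e2 : min (-c₂ * lo ^ 2) (-c₂ * hi ^ 2) = -max ((c₂ : ℚ) * lo ^ 2) (c₂ * hi ^ 2) := by
      rw [← min_neg_neg]; ring_nf
    push_cast
    rw [e1, e2]
    linarith)
  push_cast at h
  linarith

/-- **The cofactor is definite for a complex cubic**: if `Δ(F) < 0` and `F(e) = 0` (`e` real)
then `0 < 3e² + 2Ae + 4B − A²`, because `Δ(F) = ((e + A)² − 4(e² + Ae + B))·F′(e)²`.
[folklore] -/
theorem cofactor_pos_of_disc_neg {A B C : ℤ} {e : ℝ} (he : e ^ 3 + A * e ^ 2 + B * e + C = 0)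
    (hΔ : MonicCubic.disc A B C < 0) : 0 < 3 * e ^ 2 + 2 * A * e + 4 * B - A ^ 2 := by
  have hΔ' : ((MonicCubic.disc A B C : ℤ) : ℝ) < 0 := by exact_mod_cast hΔ
  have hid : ((MonicCubic.disc A B C : ℤ) : ℝ) =
      -(3 * e ^ 2 + 2 * A * e + 4 * B - A ^ 2) * (3 * e ^ 2 + 2 * A * e + B) ^ 2 := by
    simp only [MonicCubic.disc]
    push_cast
    linear_combination (-27 * (C : ℝ) + 18 * A * B - 4 * A ^ 3 + 27 * (e ^ 3 + A * e ^ 2 + B * e)) * he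
  rw [hid] at hΔ'
  nlinarith [sq_nonneg (3 * e ^ 2 + 2 * A * e + B)]

end Signs

end Summit.BirchSwinnertonDyer.BirchSwinnertonDyer.Rank2Observatory.TwoDescCubic

end
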